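/-
Copyright (c) 2026 the pub-hodgecm-mathlib formalisation cell (harness21).  Prover seat hodgecm-mathlib-K2Liu-p02 (g10), Track B «K2-LIT» ∕ hLiu418
#184♮, Road I v3, unit U5 «THE CLOSE», FACE-D₀ (theta side): THE TIE ADAPTER OF ROUTE (B3) — ED. 2's letter `hsign₂′` (and the global `hloc₂`) BY NAME from
★ (α) ∘ ★ B3-3 ED. 2 ∘ ★ B3-2b ∘ ★ B3-2c (op ∕ idx ∕ ψ) ∘ ★ B3-2a ∘ ★ B3-1, ZERO letters beyond ED. 2's frame (FACE-D₀ desk pen #3, K2 bus 2026-09-05T03:57Z).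
THEOREMS ONLY (no `def`, no `instance`, no notation, no named-fact hypothesis, no `sorry`).
-/
import Summits.HodgeConjecture.HodgeConjecture.Theorems.K2LiuDoubledLineThetaCoeffUnfolding       -- K2E3-p37 ★ B3-2b: `hsupp_skew` (over ★ B3-2a p865063, ★ B3-1 p865017)
import Summits.HodgeConjecture.HodgeConjecture.Theorems.K2LiuKappaMultiplierIndexGram              -- this seat ★ B3-2c-idx FILE 2: `kappaMultiplier_ratPt`, `Q_mem_skewMatrices`, `exists_Q_eq_dictNeg` (+ ★ p865126, ★ p865167)
import Summits.HodgeConjecture.HodgeConjecture.Theorems.K2LiuThetaSideRankOneIndexGlobalGramHerm  -- this seat ★ p865090 B3-3 ED. 2: `hfib_of_indexMap_skew`, `exists_globalGram_of_cf_thetaSide_ne_zero_herm`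
import Summits.HodgeConjecture.HodgeConjecture.Theorems.K2LiuRankOneLettersOfGlobalGram           -- K2E3-p37 ★ p864936 (α): `hloc_hsign_of_globalGram`
import Summits.HodgeConjecture.HodgeConjecture.Theorems.K2LiuUnipDeltaConjMeasurePreserving       -- ★ `lintegral_ne_zero_of_isCoveringWeight` (the `hβ0` of B3-2b from the frame)
import HarnessLib

/-!
# K2_Liu road (hLiu418 = stmt-HodgeConjecture-24832), FACE-D₀ theta side: `K2LiuThetaSideLettersOfRecord` — ED. 2's `hsign₂′` BY NAME (route (B3) tie adapter)

Cell `pub/hodgecm-mathlib` (D-0151), Track B, build stream 29; helper lane `--supports stmt-HodgeConjecture-24832 --as helper`, count-neutral; closes no socket.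

THE CHAIN (all ★, FACE-D₀ desk ledger 2026-09-05): for the theta side `T₂ x = Θ̃_{𝓣 x}(fw)` of ★ p864979 `K2LiuRigidityRowsOfRecordNegKeyed.rigidityRows_of_rowLetters_negKeyed`
(row letters keyed on the conjugate dictionary `dict′ β = (−δ) • (T_L⁻¹ · β^{ρ⁻¹})`, RULING M-160i), a surviving rank-one index `b • ū ⊗ u` satisfies
`locF b w = locF a′ w` at every finite `w` AND `0 < ρ′(b · a′⁻¹)` at every real `ρ′`:
* ★ B3-2c (K2E3-p23 p865126 `pairRep_line_lineCayley_eq_chirpLM` ∕ `thetaDist_lineCayleyTg`; this seat p865223 + `K2LiuKappaMultiplierIndexGram`; K2E3-p26 p865167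
  `adeleAddChar_baseChange_cm_eq_add`) — the rational κ-multiplier model: `Tg`, `hΘ`, the index map `Q`, `hmult := kappaMultiplier_ratPt`, `hQskew := Q_mem_skewMatrices`,
  `hQ := exists_Q_eq_dictNeg` (label `a′`);
* ★ B3-2b (K2E3-p37 `K2LiuDoubledLineThetaCoeffUnfolding.hsupp_skew`, over ★ B3-2a p865063 Fubini and ★ B3-1 p865017 orthogonality) — the guarded support letter
  «`S` skew, `cf_S(Θ̃_Φ(fw))(h) ≠ 0 ⇒ ∃ ξ, Q ξ = S`»;
* ★ B3-3 ED. 2 (this seat p865090) — `hfib_of_indexMap_skew` ⇒ the hermitian-guarded fibre letter, `exists_globalGram_of_cf_thetaSide_ne_zero_herm` ⇒ `b = a′ · c(e) · e`;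
* ★ (α) (K2E3-p37 p864936 `hloc_hsign_of_globalGram`) ⇒ both letters.
THIS FILE composes them in ED. 2's frame: §1 `hloc_hsign_thetaSide_of_record` (the (α)-pair for the survival predicate «a coefficient of some `T₂ x` at `dict′(b • ū ⊗ u)`
is non-zero at some `h`»), §2 **`hsign₂_of_record`** — ★ p864979's binder `hsign₂'` BYTES VERBATIM, no letters — and `hloc₂_global_of_record` (the global re-payment of
★ p864604's per-place class letter).  The only frame derivation inside is B3-2b's positive mass `hβ0` (★ `lintegral_ne_zero_of_isCoveringWeight` under ★
`countable_unipDeltaRat`, as ★ p864993).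
No definition, no instance, no notation, no named-fact hypothesis, no `sorry`; axioms ⊆ {propext, Classical.choice, Quot.sound}.
HONEST LABEL: after this file the FACE-D₀ slot `hsign₂'` of ★ p864979 is PAYABLE BY NAME (the tie is typ3's); the residue-side letters `hfac`, `hsign₁′` and `h1′` remain;
HC_CM is proved only modulo the 7 printed citations (2 remaining named inputs: hLiu418 = stmt-HodgeConjecture-24832, h413 = stmt-HodgeConjecture-24833) until rung 0 closes.

References: [KudlaRallis1994] S. Kudla, S. Rallis, Ann. of Math. 140 (1994), §3; [Rallis1984] §4; [Weil1964] Chap. I n° 13, n° 34, Chap. III n° 41; [Liu2021] Def. 4.11–4.12,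
App. B Prop. B.8 p. 104; [Omeara1963] §65D; [Scharlau1985HermitianForms] Ch. 10 §1; [CasselsFrohlichANT1967] Ch. XV §4.1.
-/

set_option autoImplicit false
set_option linter.dupNamespace false
-- the line-pair carriers elaborate to very large types; elaborate sequentially (as ★ p864979 ∕ ★ B3-2b)
set_option Elab.async false

noncomputable section

open NumberField NumberField.mixedEmbedding MeasureTheory IsDedekindDomain
open scoped Matrix ComplexOrder ENNReal TensorProduct SchwartzMap Classical  -- `Classical`: the `Fintype` of real ∕ complex places inside `mixedSpace` (as ★ p864979)

namespace Summit.HodgeConjecture.HodgeConjecture.Cruxes.HLiu418.K2LiuThetaSideLettersOfRecord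

open Literature.NumberTheory.Automorphic Literature.NumberTheory.Automorphic.UnitaryGroup
open Literature.NumberTheory.Automorphic.UnitaryGroup.QuadraticCoordinates
open Literature.NumberTheory.Automorphic.IdeleClassGroup
open Literature.NumberTheory.Automorphic.Liu2021
open Literature.NumberTheory.Automorphic.Liu2021.Def411WeilCarriers
open Literature.NumberTheory.Automorphic.Liu2021.Def411WeilCarriersDoubling
open Literature.NumberTheory.GelbartRogawski1991 Literature.NumberTheory.GelbartRogawski1991.UnitaryDualPair
open Literature.NumberTheory.GelbartRogawski1991.GRConstruction
open Literature.NumberTheory.GaloisRepresentations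
open Literature.NumberTheory.Weil1964
open Literature.RepresentationTheory Literature.RepresentationTheory.Liu2021
open Literature.RepresentationTheory.HeisenbergGroup
open Literature.NumberTheory.K2Lit.DoubledLineTheta Literature.NumberTheory.K2Lit.SiegelDoubled
open Literature.MeasureTheory.Group
open Summit.HodgeConjecture.HodgeConjecture.Cruxes.HLiu418.K2LiuSiegelUnipotentFourierDefs
open Summit.HodgeConjecture.HodgeConjecture.Cruxes.HLiu418.K2LiuUnipotentCoveringWeight
open Summit.HodgeConjecture.HodgeConjecture.Cruxes.HLiu418.K2LiuLinePairCayleySiegel (lineCayleyMover_mem_symplecticGroup)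
open Summit.HodgeConjecture.HodgeConjecture.Cruxes.HLiu418.K2LiuLinePairKappaModelChirpGlobal (thetaDist_lineCayleyTg)
open Summit.HodgeConjecture.HodgeConjecture.Cruxes.HLiu418.K2LiuKappaMultiplierIndexGram (kappaMultiplier_ratPt Q_mem_skewMatrices exists_Q_eq_dictNeg)
open Summit.HodgeConjecture.HodgeConjecture.Cruxes.HLiu418.K2LiuDoubledLineThetaCoeffUnfolding (hsupp_skew)
open Summit.HodgeConjecture.HodgeConjecture.Cruxes.HLiu418.K2LiuThetaSideRankOneIndexGlobalGramHerm (hfib_of_indexMap_skew exists_globalGram_of_cf_thetaSide_ne_zero_herm)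
open Summit.HodgeConjecture.HodgeConjecture.Cruxes.HLiu418.K2LiuRankOneLettersOfGlobalGram (hloc_hsign_of_globalGram)
open Summit.HodgeConjecture.HodgeConjecture.Cruxes.HLiu418.K2LiuUnipDeltaConjMeasurePreserving (lintegral_ne_zero_of_isCoveringWeight)

variable (L : Type) [Field L] [NumberField L] [IsCMField L]
variable {N n : ℕ} (e : Fin N × Fin 1 ≃ Fin n)
  (dV : Fin N → L) (hdV : ∀ i, IsCMField.complexConj L (dV i) = dV i)
  (dW : Fin 1 → L) (hdW : ∀ i, IsCMField.complexConj L (dW i) = dW i)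
  {n'' : ℕ} (e₁ : Fin (n + n) × Fin 1 ≃ Fin n'')
  (hdV0 : ∀ i, dV i ≠ 0) (hdW0 : ∀ i, dW i ≠ 0)
  (lam : Literature.NumberTheory.Automorphic.IdeleClassGroup L →ₜ* Circle) (hlam : IsConjugateSymplectic L lam) (a' : (Fp L)ˣ)
  (hρ : HasThetaMajorants fun
      (p : ↥(UnitaryGroup.adelic (Fp L) L (IsCMField.complexConj L) (n + n) (Matrix.diagonal (dD L e dV hdV dW hdW))) ×
        ↥(UnitaryGroup.adelic (Fp L) L (IsCMField.complexConj L) 1 (JW (Fp L) L a')))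
      (Φ : piSchwartzBruhat (Fp L) (Fin n'')) =>
        pairRep (Fp L) L (IsCMField.complexConj L) (n + n) 1 e₁ (Matrix.diagonal (dD L e dV hdV dW hdW)) (JW (Fp L) L a')
          (chiSplittingLine L e₁ (dD L e dV hdV dW hdW) (dD_conj L e dV hdV dW hdW) (dD_ne_zero L e dV hdV dW hdW hdV0 hdW0)
            (toHeckeCharacter L lam) (isUnitary_toHeckeCharacter L lam)
            ((isOscillatorChar_toHeckeCharacter_iff lam).mpr hlam) (TW (Fp L) a')
            (isUnit_det_TW (Fp L) a') (JW (Fp L) L a') (JW_eq (Fp L) L a'))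
          p Φ)
  [MeasurableSpace (↥(UnitaryGroup.adelic (Fp L) L (IsCMField.complexConj L) 1 (JW (Fp L) L a')) ⧸
    (UnitaryGroup.toAdelic (Fp L) L (IsCMField.complexConj L) 1 (JW (Fp L) L a')).range)]
  [BorelSpace (↥(UnitaryGroup.adelic (Fp L) L (IsCMField.complexConj L) 1 (JW (Fp L) L a')) ⧸
    (UnitaryGroup.toAdelic (Fp L) L (IsCMField.complexConj L) 1 (JW (Fp L) L a')).range)]
  (μW : Measure (↥(UnitaryGroup.adelic (Fp L) L (IsCMField.complexConj L) 1 (JW (Fp L) L a')) ⧸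
    (UnitaryGroup.toAdelic (Fp L) L (IsCMField.complexConj L) 1 (JW (Fp L) L a')).range)) [IsFiniteMeasure μW]
  (fw : C(↥(UnitaryGroup.adelic (Fp L) L (IsCMField.complexConj L) 1 (JW (Fp L) L a')) ⧸
    (UnitaryGroup.toAdelic (Fp L) L (IsCMField.complexConj L) 1 (JW (Fp L) L a')).range, ℂ))
  [MeasurableSpace (unipDelta L e dV hdV dW hdW)] [BorelSpace (unipDelta L e dV hdV dW hdW)]
  (νN : Measure (unipDelta L e dV hdV dW hdW)) [νN.IsHaarMeasure]
  {βw : unipDelta L e dV hdV dW hdW → ℝ≥0∞} (hβ : IsCoveringWeight (unipDeltaRat L e dV hdV dW hdW) βw) (hβtop : ∫⁻ u, βw u ∂νN ≠ ∞)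
  {K : Set (unipDelta L e dV hdV dW hdW)} (hK : IsCompact K) (hβK : ∀ u, βw u ≤ K.indicator 1 u)
  (ρ : Fin n ≃ Fin 2)

include hβ hβtop hK hβK

set_option maxHeartbeats 4000000 in -- the doubled-carrier telescope of socket #42F′ (as ★ FaceDefs `RigidityRowsOn` ∕ ★ p864979)
/-- **THE THETA SIDE'S RANK-ONE LETTERS, BOTH, FROM ROUTE (B3).**  For a side `T₂` that IS the doubled line theta lift after a Schwartz-side map `𝓣`
(`hT₂B`, ★ p862640's pointwise law), the survival predicate «the coefficient of some `T₂ x` at `dict′(b • ū ⊗ u)` is non-zero at some `h`» implies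
`locF b w = locF a′ w` at every finite `w` and `0 < ρ′(b · a′⁻¹)` at every `ρ′ : L⁺ →+* ℝ` — ★ (α) over ★ B3-3 ED. 2 over ★ B3-2b's guarded support letter in the
★ B3-2c rational κ-multiplier model (`Tg`, `hΘ`, `Q`, `hmult`, `hQskew`, `hQ` all by name).  `hβ0` is derived from the frame (★ `lintegral_ne_zero_of_isCoveringWeight`).
[cite: KudlaRallis1994, §3] [cite: Weil1964, Chap. III n° 41 Thm 6 p. 193] [cite: Liu2021, Def. 4.11–4.12; App. B Prop. B.8 p. 104] [cite: Omeara1963, §65D Thm. 65:23] -/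
theorem hloc_hsign_thetaSide_of_record {D : Type*} (𝓣 : D → piSchwartzBruhat (Fp L) (Fin n'')) (T₂ : D → HA L e dV hdV dW hdW → ℂ)
    (hT₂B : ∀ x (h : HA L e dV hdV dW hdW), T₂ x h = doubledLineThetaLift L e dV hdV dW hdW e₁ hdV0 hdW0 lam hlam a' hρ μW (𝓣 x) fw h) :
    (∀ (w : HeightOneSpectrum (𝓞 (Fp L))) (b : (Fp L)ˣ) (u : Fin 2 → L), (∃ k, u k = 1) →
        (∃ (x : D) (h : HA L e dV hdV dW hdW),
          fourierCoeffDelta L e dV hdV dW hdW νN βw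
            ((-imagUnit L) • (((gramR L e dV hdV dW hdW).map (algebraMap (Fp L) L))⁻¹ *
              Matrix.reindex ρ.symm ρ.symm (algebraMap (Fp L) L (b : Fp L) • Matrix.vecMulVec (⇑(IsCMField.complexConj L) ∘ u) u))) (T₂ x) h ≠ 0) →
        locF (Fp L) (imagUnitSq L) b w = locF (Fp L) (imagUnitSq L) a' w) ∧
      (∀ (b : (Fp L)ˣ) (u : Fin 2 → L), (∃ k, u k = 1) →
        (∃ (x : D) (h : HA L e dV hdV dW hdW),
          fourierCoeffDelta L e dV hdV dW hdW νN βw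
            ((-imagUnit L) • (((gramR L e dV hdV dW hdW).map (algebraMap (Fp L) L))⁻¹ *
              Matrix.reindex ρ.symm ρ.symm (algebraMap (Fp L) L (b : Fp L) • Matrix.vecMulVec (⇑(IsCMField.complexConj L) ∘ u) u))) (T₂ x) h ≠ 0) →
        ∀ ρ' : Fp L →+* ℝ, 0 < ρ' ((b : Fp L) * ((a' : Fp L))⁻¹)) := by
  haveI : Countable (unipDeltaRat L e dV hdV dW hdW) := countable_unipDeltaRat L e dV hdV dW hdW
  have hβ0 : ∫⁻ u, βw u ∂νN ≠ 0 := lintegral_ne_zero_of_isCoveringWeight νN (NeZero.ne νN) (unipDeltaRat L e dV hdV dW hdW) hβ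
  -- the guarded support letter of the theta lifts (★ B3-2b in the ★ B3-2c model) ⇒ the hermitian-guarded fibre letter (★ B3-3 ED. 2)
  have hfibΘ := hfib_of_indexMap_skew L e dV hdV dW hdW νN βw ρ a' hdV0 hdW0
    (fun Φ : piSchwartzBruhat (Fp L) (Fin n'') => doubledLineThetaLift L e dV hdV dW hdW e₁ hdV0 hdW0 lam hlam a' hρ μW Φ fw) _
    (exists_Q_eq_dictNeg L e dV hdV dW hdW e₁ a' ρ)
    (hsupp_skew L e dV hdV dW hdW e₁ hdV0 hdW0 lam hlam a' hρ μW fw νN hβ hβ0 hβtop hK hβK _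
      (fun Ψ => thetaDist_lineCayleyTg L e dV hdV dW hdW e₁ hdV0 hdW0 a' Ψ) _
      (kappaMultiplier_ratPt L e dV hdV hdV0 dW hdW hdW0 e₁ lam hlam a') (Q_mem_skewMatrices L e dV hdV hdV0 dW hdW hdW0 e₁ a'))
  -- ★ (α) over ★ B3-3 ED. 2 §3
  exact hloc_hsign_of_globalGram L a' _ fun b u hu hs =>
    exists_globalGram_of_cf_thetaSide_ne_zero_herm L e dV hdV dW hdW e₁ hdV0 hdW0 lam hlam a' hρ μW fw νN βw ρ 𝓣 T₂ hT₂B hfibΘ b u hu hs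

set_option maxHeartbeats 4000000 in -- idem
/-- **ED. 2's LETTER `hsign₂'` BY NAME** (★ p864979 `rigidityRows_of_rowLetters_negKeyed`, binder :145–:149 VERBATIM): for the theta side
`T₂ x = Θ̃_{𝓣 x}(fw)` on the carrier of record, a surviving rank-one index `b • ū ⊗ u` (`u` with a coordinate `1`) at the conjugate dictionary has `b · a′⁻¹`
TOTALLY POSITIVE.  Route (B3): global unfolding ⇒ global Gram ⇒ `|τ e|² > 0`. [cite: KudlaRallis1994, §3] [cite: Liu2021, App. B Prop. B.8 p. 104] [cite: Omeara1963, §65D] -/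
theorem hsign₂_of_record {n' : ℕ} (V : Submodule ℂ 𝓢(((Fin (n' + n')) → mixedSpace (Fp L)), ℂ))
    (𝓣 : ↥(Submodule.span ℂ {x : piSchwartzBruhat (Fp L) (Fin (n' + n')) |
            ∃ a ∈ V, ∃ f : FinSB (Fp L) (Fin (n' + n')), x = piSchwartzBruhatEquiv (Fp L) (Fin (n' + n')) (a ⊗ₜ[ℂ] f)}) →ₗ[ℂ]
        piSchwartzBruhat (Fp L) (Fin n''))
    (T₂ : ↥(Submodule.span ℂ {x : piSchwartzBruhat (Fp L) (Fin (n' + n')) |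
            ∃ a ∈ V, ∃ f : FinSB (Fp L) (Fin (n' + n')), x = piSchwartzBruhatEquiv (Fp L) (Fin (n' + n')) (a ⊗ₜ[ℂ] f)}) →ₗ[ℂ] (HA L e dV hdV dW hdW → ℂ))
    (hT₂B : ∀ x (h : HA L e dV hdV dW hdW), T₂ x h = doubledLineThetaLift L e dV hdV dW hdW e₁ hdV0 hdW0 lam hlam a' hρ μW (𝓣 x) fw h) :
    ∀ (b : (↥(maximalRealSubfield L))ˣ) (u : Fin 2 → L), (∃ k, u k = 1) →
      (∃ (x : ↥(Submodule.span ℂ {x : piSchwartzBruhat (Fp L) (Fin (n' + n')) |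
            ∃ a ∈ V, ∃ f : FinSB (Fp L) (Fin (n' + n')), x = piSchwartzBruhatEquiv (Fp L) (Fin (n' + n')) (a ⊗ₜ[ℂ] f)})) (h : HA L e dV hdV dW hdW),
        fourierCoeffDelta L e dV hdV dW hdW νN βw ((-imagUnit L) • (((gramR L e dV hdV dW hdW).map (algebraMap (Fp L) L))⁻¹ * Matrix.reindex ρ.symm ρ.symm (algebraMap ↥(maximalRealSubfield L) L b • Matrix.vecMulVec (⇑(IsCMField.complexConj L) ∘ u) u))) (T₂ x) h ≠ 0) →
      ∀ ρ' : ↥(maximalRealSubfield L) →+* ℝ, 0 < ρ' ((b : ↥(maximalRealSubfield L)) * ((a' : ↥(maximalRealSubfield L)))⁻¹) :=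
  (hloc_hsign_thetaSide_of_record L e dV hdV dW hdW e₁ hdV0 hdW0 lam hlam a' hρ μW fw νN hβ hβtop hK hβK ρ ⇑𝓣 ⇑T₂ hT₂B).2

set_option maxHeartbeats 4000000 in -- idem
/-- **THE GLOBAL CLASS LETTER `hloc₂` (all finite places at once)** — the route-(B3) re-payment of ★ p864604 `hloc_thetaSide_at_place`: a surviving rank-one index
`b • ū ⊗ u` of the theta side at the conjugate dictionary has `locF b w = locF a′ w` for EVERY finite `w`. [cite: KudlaRallis1994, §3] [cite: Liu2021, Def. 4.11–4.12] -/
theorem hloc₂_global_of_record {n' : ℕ} (V : Submodule ℂ 𝓢(((Fin (n' + n')) → mixedSpace (Fp L)), ℂ))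
    (𝓣 : ↥(Submodule.span ℂ {x : piSchwartzBruhat (Fp L) (Fin (n' + n')) |
            ∃ a ∈ V, ∃ f : FinSB (Fp L) (Fin (n' + n')), x = piSchwartzBruhatEquiv (Fp L) (Fin (n' + n')) (a ⊗ₜ[ℂ] f)}) →ₗ[ℂ]
        piSchwartzBruhat (Fp L) (Fin n''))
    (T₂ : ↥(Submodule.span ℂ {x : piSchwartzBruhat (Fp L) (Fin (n' + n')) |
            ∃ a ∈ V, ∃ f : FinSB (Fp L) (Fin (n' + n')), x = piSchwartzBruhatEquiv (Fp L) (Fin (n' + n')) (a ⊗ₜ[ℂ] f)}) →ₗ[ℂ] (HA L e dV hdV dW hdW → ℂ))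
    (hT₂B : ∀ x (h : HA L e dV hdV dW hdW), T₂ x h = doubledLineThetaLift L e dV hdV dW hdW e₁ hdV0 hdW0 lam hlam a' hρ μW (𝓣 x) fw h)
    (w : HeightOneSpectrum (𝓞 ↥(maximalRealSubfield L))) (b : (↥(maximalRealSubfield L))ˣ) (u : Fin 2 → L) (hu : ∃ k, u k = 1)
    (hne : ∃ (x : ↥(Submodule.span ℂ {x : piSchwartzBruhat (Fp L) (Fin (n' + n')) |
            ∃ a ∈ V, ∃ f : FinSB (Fp L) (Fin (n' + n')), x = piSchwartzBruhatEquiv (Fp L) (Fin (n' + n')) (a ⊗ₜ[ℂ] f)})) (h : HA L e dV hdV dW hdW),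
        fourierCoeffDelta L e dV hdV dW hdW νN βw ((-imagUnit L) • (((gramR L e dV hdV dW hdW).map (algebraMap (Fp L) L))⁻¹ * Matrix.reindex ρ.symm ρ.symm (algebraMap ↥(maximalRealSubfield L) L b • Matrix.vecMulVec (⇑(IsCMField.complexConj L) ∘ u) u))) (T₂ x) h ≠ 0) :
    locF ↥(maximalRealSubfield L) (imagUnitSq L) b w = locF ↥(maximalRealSubfield L) (imagUnitSq L) a' w :=
  (hloc_hsign_thetaSide_of_record L e dV hdV dW hdW e₁ hdV0 hdW0 lam hlam a' hρ μW fw νN hβ hβtop hK hβK ρ ⇑𝓣 ⇑T₂ hT₂B).1 w b u hu hne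

end Summit.HodgeConjecture.HodgeConjecture.Cruxes.HLiu418.K2LiuThetaSideLettersOfRecord

end
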